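import Mathlib.Analysis.SpecialFunctions.Pow.Real
import Mathlib.Analysis.SpecialFunctions.Sqrt

/-!
# EriceRemainderEnclosureHistoryAutonomyComparisonTowerChainTen — (E65g) THE BUDGET CLOSES THE DUAL CHAIN ON TOWERS OF RATIO `≥ 10`: for a finite age set `A` with
# consecutive ratios `≥ 10` (`10·pred k ≤ k`) and ANY loads `x ≥ 0` obeying the consequence `x_k√(k∕2k) + Σ_{s<k} x_s√(s∕(s+k)) ≤ 1∕2` of the window budget
# (E65a) at the scales `j = k ∈ A`, the chain values `λ_k = 4·Z_k`, `Z_k = Σ_{s≤k} x_s√(s∕k)`, and the matching `μ_k` satisfy every inequality of the dual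
# chain of (E65e)∕(E65f) — the first instance of route (C″) «budget ⟹ chain», by one polynomial inequality in two variables (`step_poly`).  Mathlib only.
# With (E65f): towers of consecutive ratio `≥ 10`, ANY height, ANY sizes and Markov weight compare ((E65h); (E64g)∕(E64h) needed ratio `14`)

Cell `pub-balaban`, β-function sub-cell, BINDER row D4 «RemainderConst leaves for Bałaban's split» (`HOME/BINDER-OWNERS.md`; owner lineage `b2b-balaban-beta-an4`;
this file by co-owner #2 lineage `b2b-balaban-beta-d4-p2`, generation 58), β-FLOW TEAM duty (1), FREEZE (0) honoured (def-free; Mathlib only).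

HONEST FRAMING (page 1, verbatim and binding).  *"Discharging BetaPertH makes Bałaban's UV stability UNCONDITIONAL — a real constructive-QFT result; it is
NOT the continuum limit and NOT the Clay problem."*  THIS FILE DISCHARGES NOTHING OF THE KIND.  A lemma about finitely many non-negative reals; its use is
through (E65f), whose hypotheses are those of a census, not facts; nothing of Bałaban's is asserted.  Row D4 class UNCHANGED (critical-path width 0; instance
0∕1; D4 DISCHARGE NO DATE).  HONEST DEPENDENCY: continuum YM on T⁴ ⇐ BetaPertH ∧ nine spine estimates (0/9 proved); BetaPertH ⇐ (D1) ∧ (D4) ∧ CAP+tail;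
G-an2-4 gates asym, D1 and NE2/3/4.

THE POINT (census sense (α); the COMPARISON column, conjecture (E58′), route (C″)).  On a tower only the far-field potential is needed: with `r = k⁻∕k ≤ 1∕10`
the defect factor is `e_k ≤ 2λ_{k⁻}r`.  Take `λ_k = C·Z_k` with the «young pressure in the chain's own currency» `Z_k = Σ_{s≤k} x_s√(s∕k)`, which obeys the
exact recursion `Z_k = x_k + √r·Z_{k⁻}`, while the budget at scale `k` bounds the same pressure in ITS currency: `√(r∕(1+r))·Z_{k⁻} ≤ Σ_{s<k} x_s√(s∕(s+k)) ≤
1∕2 − x_k∕√2`.  In the variables `x = x_k`, `u = √r·Z_{k⁻}` the λ-recursion becomes `4us(1 + x∕4) + x(1 + 8su) ≤ 4(x+u)(1 − x(3∕4 + 8su))` (`s = √r`) on the region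
`u ≤ √(1+r)(1∕2 − x∕√2)`, and with `C = 4`, `s ≤ 19∕60` (`r ≤ 1∕10`), `u ≤ (21∕20)(1∕2 − 7x∕10)`, `x ≤ 71∕100` it holds with margin `≥ 0.29(x+u)` (`nlinarith`, §1);
the condition value `x(3∕4 + 8su) ≤ 0.59`.  At ratio `8` the margin is `0.12`, at `7` it is `0.001` — the crude weight `√(s∕(s+k))` (true window weight `S_{s,k}∕k`
is larger by up to `27 %`) is what stops this file at `10`; the general inequality «window budget ⟹ dual chain» is OPEN (README).  NOT CLAIMED: ratios below
`10`; anything printed.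

WHAT IS PROVED ([folklore]; 0 `def`, 0 sorry; Mathlib only).  §1 `step_poly`, `cond_poly`.  §2 **`dual_chain_of_tower_ten`**.
-/
noncomputable section
open Finset

namespace Summit.QuantumFields.BalabanUV.Beta.EriceRemainderEnclosureHistoryAutonomyComparisonTowerChainTen

/-! ## §1 The two-variable polynomial inequalities -/

/-- The λ-recursion of the dual chain on a tower of ratio `≥ 10`, at the extreme transport `s = 19∕60 ≥ √(1∕10)`, in the variables `x` (the new load) and
`u` (the transported young pressure): `4us(1 + x∕4) + x(1 + 8su) ≤ 4(x+u)(1 − x(3∕4 + 8su))` on `0 ≤ x ≤ 71∕100`, `0 ≤ u ≤ (21∕20)(1∕2 − 7x∕10)`. [folklore] -/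
theorem step_poly {x u : ℝ} (hx : 0 ≤ x) (hx1 : x ≤ 71 / 100) (hu : 0 ≤ u) (hu1 : u ≤ 21 / 20 * (1 / 2 - 7 / 10 * x)) :
    4 * u * (19 / 60) * (1 + x / 4) + x * (1 + 8 * (19 / 60) * u) ≤ 4 * (x + u) * (1 - x * (3 / 4 + 8 * (19 / 60) * u)) := by
  nlinarith [mul_nonneg hx hu, mul_nonneg hx (sub_nonneg.mpr hx1), mul_nonneg hu (sub_nonneg.mpr hu1),
    mul_nonneg hx (sub_nonneg.mpr hu1), mul_nonneg hu (sub_nonneg.mpr hx1),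
    mul_nonneg (mul_nonneg hx hu) (sub_nonneg.mpr hu1), mul_nonneg (mul_nonneg hx hx) (sub_nonneg.mpr hu1),
    mul_nonneg (mul_nonneg hu hu) (sub_nonneg.mpr hx1), mul_nonneg (mul_nonneg hx hu) (sub_nonneg.mpr hx1)]

/-- The chain condition on the same region: `x(3∕4 + 8·(19∕60)·u) < 1` (its maximum is `0.59`). [folklore] -/
theorem cond_poly {x u : ℝ} (hx : 0 ≤ x) (hx1 : x ≤ 71 / 100) (_hu : 0 ≤ u) (hu1 : u ≤ 21 / 20 * (1 / 2 - 7 / 10 * x)) :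
    x * (8 * (19 / 60) * u + 3 / 4) < 1 := by
  nlinarith [mul_nonneg hx (sub_nonneg.mpr hx1), mul_nonneg hx (sub_nonneg.mpr hu1)]

/-! ## §2 The dual chain on a tower of ratio `≥ 10` -/

set_option maxHeartbeats 800000 in
/-- **THE BUDGET CLOSES THE DUAL CHAIN ON TOWERS OF RATIO `≥ 10`.**  `A` a finite set of ages `≥ 1` with minimum `m₀` and predecessor map `pred`, consecutive
ratios `10·pred k ≤ k`; loads `x ≥ 0` with `x_k·√(k∕(k+k)) + Σ_{s∈A, s<k} x_s·√(s∕(s+k)) ≤ 1∕2` for every `k ∈ A` (the window budget of (E65a) at `j = k` read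
through `S_{s,k} ≥ k√(s∕(s+k))`).  Then there are `μ, λ ≥ 0` on `A` satisfying every inequality of the dual chain of (E65e) (as demanded by (E65f)):
`λ_k = 4Σ_{s≤k} x_s√(s∕k)`, `μ_{m₀} = (3x∕4)∕(1 − 3x∕4)`, `μ_k = (ē(1+x) + 3x∕4)∕(1 − x(3∕4 + ē))` with `ē = 2λ_{k⁻}k⁻∕k ≥ e_k`. [folklore] -/
theorem dual_chain_of_tower_ten {A : Finset ℕ} {x : ℕ → ℝ} {pred : ℕ → ℕ} {m₀ : ℕ}
    (hA1 : ∀ k ∈ A, 1 ≤ k) (hx : ∀ k ∈ A, 0 ≤ x k) (hm₀ : m₀ ∈ A) (hmin : ∀ k ∈ A, m₀ ≤ k)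
    (hpred : ∀ k ∈ A, k ≠ m₀ → pred k ∈ A ∧ pred k < k ∧ ∀ k'' ∈ A, k'' < k → k'' ≤ pred k)
    (hten : ∀ k ∈ A, k ≠ m₀ → 10 * pred k ≤ k)
    (hbud : ∀ k ∈ A, x k * Real.sqrt ((k : ℝ) / ((k : ℝ) + k)) +
      ∑ s ∈ A.filter (fun s => s < k), x s * Real.sqrt ((s : ℝ) / ((s : ℝ) + k)) ≤ 1 / 2) :
    ∃ μ lam : ℕ → ℝ, (∀ k ∈ A, 0 ≤ μ k) ∧ (∀ k ∈ A, 0 ≤ lam k) ∧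
      3 / 4 * x m₀ ≤ μ m₀ * (1 - 3 / 4 * x m₀) ∧ x m₀ ≤ lam m₀ * (1 - 3 / 4 * x m₀) ∧
      (∀ k ∈ A, k ≠ m₀ →
        x k * (min (4 * (pred k : ℝ) * k / ((k : ℝ) + pred k) ^ 2 * μ (pred k)) (2 * lam (pred k) * ((pred k : ℝ) / k)) + 3 / 4) < 1) ∧
      (∀ k ∈ A, k ≠ m₀ →
        min (4 * (pred k : ℝ) * k / ((k : ℝ) + pred k) ^ 2 * μ (pred k)) (2 * lam (pred k) * ((pred k : ℝ) / k)) * (1 + x k) + 3 / 4 * x k ≤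
          μ k * (1 - x k * (3 / 4 + min (4 * (pred k : ℝ) * k / ((k : ℝ) + pred k) ^ 2 * μ (pred k)) (2 * lam (pred k) * ((pred k : ℝ) / k))))) ∧
      (∀ k ∈ A, k ≠ m₀ →
        lam (pred k) * ((pred k : ℝ) / k) * (1 + x k / 4) +
            x k * (1 + min (4 * (pred k : ℝ) * k / ((k : ℝ) + pred k) ^ 2 * μ (pred k)) (2 * lam (pred k) * ((pred k : ℝ) / k))) ≤
          lam k * (1 - x k * (3 / 4 + min (4 * (pred k : ℝ) * k / ((k : ℝ) + pred k) ^ 2 * μ (pred k)) (2 * lam (pred k) * ((pred k : ℝ) / k))))) := by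
  -- constants
  have hhalf : (7 : ℝ) / 10 ≤ Real.sqrt (1 / 2) := by
    rw [show (7 : ℝ) / 10 = Real.sqrt ((7 / 10) ^ 2) by rw [Real.sqrt_sq (by norm_num)]]
    exact Real.sqrt_le_sqrt (by norm_num)
  have hhalf' : (50 : ℝ) / 71 ≤ Real.sqrt (1 / 2) := by
    rw [show (50 : ℝ) / 71 = Real.sqrt ((50 / 71) ^ 2) by rw [Real.sqrt_sq (by norm_num)]]
    exact Real.sqrt_le_sqrt (by norm_num)
  have hdiag : ∀ k : ℕ, 1 ≤ k → Real.sqrt ((k : ℝ) / ((k : ℝ) + k)) = Real.sqrt (1 / 2) := by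
    intro k hk
    have hkr : (0 : ℝ) < k := by exact_mod_cast hk
    congr 1; field_simp; ring
  -- the load cap from the budget at the age's own scale
  have hcap : ∀ k ∈ A, x k ≤ 71 / 100 := by
    intro k hk
    have hb := hbud k hk
    rw [hdiag k (hA1 k hk)] at hb
    have hs : 0 ≤ ∑ s ∈ A.filter (fun s => s < k), x s * Real.sqrt ((s : ℝ) / ((s : ℝ) + k)) :=
      sum_nonneg fun s hs => mul_nonneg (hx s (mem_filter.mp hs).1) (Real.sqrt_nonneg _)
    have h1 : x k * Real.sqrt (1 / 2) ≤ 1 / 2 := by linarith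
    have h2 : x k * (50 / 71) ≤ x k * Real.sqrt (1 / 2) := mul_le_mul_of_nonneg_left hhalf' (hx k hk)
    linarith
  -- the chain's young pressure Z and the chain values
  obtain ⟨Z, hZ_def⟩ : ∃ Z : ℕ → ℝ, Z = fun k => ∑ s ∈ A.filter (fun s => s ≤ k), x s * Real.sqrt ((s : ℝ) / k) := ⟨_, rfl⟩
  have hZ0 : ∀ k, 0 ≤ Z k := fun k => by
    rw [hZ_def]; exact sum_nonneg fun s hs => mul_nonneg (hx s (mem_filter.mp hs).1) (Real.sqrt_nonneg _)
  obtain ⟨lam, hlam_def⟩ : ∃ lam : ℕ → ℝ, lam = fun k => 4 * Z k := ⟨_, rfl⟩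
  obtain ⟨eb, heb_def⟩ : ∃ eb : ℕ → ℝ, eb = fun k => 2 * lam (pred k) * ((pred k : ℝ) / k) := ⟨_, rfl⟩
  obtain ⟨μ, hμ_def⟩ : ∃ μ : ℕ → ℝ, μ = fun k => if k = m₀ then (3 / 4 * x m₀) / (1 - 3 / 4 * x m₀)
      else (eb k * (1 + x k) + 3 / 4 * x k) / (1 - x k * (3 / 4 + eb k)) := ⟨_, rfl⟩
  have hlam0 : ∀ k, 0 ≤ lam k := fun k => by rw [hlam_def]; exact mul_nonneg (by norm_num) (hZ0 k)
  have heb0 : ∀ k, 0 ≤ eb k := fun k => by rw [heb_def]; have := hlam0 (pred k); positivity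
  -- Z at the minimum and the splitting at a non-minimal age
  have hZm : Z m₀ = x m₀ := by
    have hset : A.filter (fun s => s ≤ m₀) = {m₀} := by
      ext s; simp only [mem_filter, mem_singleton]
      constructor
      · rintro ⟨hs, hsm⟩; exact le_antisymm hsm (hmin s hs)
      · rintro rfl; exact ⟨hm₀, le_rfl⟩
    have hm1 : (0 : ℝ) < m₀ := by exact_mod_cast hA1 m₀ hm₀
    rw [hZ_def]; simp only [hset, sum_singleton]
    rw [div_self hm1.ne', Real.sqrt_one, mul_one]
  have hsplit : ∀ k ∈ A, k ≠ m₀ →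
      Z k = x k + Real.sqrt ((pred k : ℝ) / k) * Z (pred k) ∧
      A.filter (fun s => s < k) = A.filter (fun s => s ≤ pred k) := by
    intro k hk hne
    obtain ⟨hpA, hplt, hpmax⟩ := hpred k hk hne
    have hkr : (0 : ℝ) < k := by exact_mod_cast hA1 k hk
    have hpr : (0 : ℝ) < pred k := by exact_mod_cast hA1 _ hpA
    have hset1 : A.filter (fun s => s < k) = A.filter (fun s => s ≤ pred k) := by
      ext s; simp only [mem_filter]
      constructor
      · rintro ⟨hs, hsk⟩; exact ⟨hs, hpmax s hs hsk⟩
      · rintro ⟨hs, hsp⟩; exact ⟨hs, lt_of_le_of_lt hsp hplt⟩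
    have hset2 : A.filter (fun s => s ≤ k) = insert k (A.filter (fun s => s ≤ pred k)) := by
      ext s; simp only [mem_filter, mem_insert]
      constructor
      · rintro ⟨hs, hsk⟩
        rcases lt_or_eq_of_le hsk with h | h
        · exact Or.inr ⟨hs, hpmax s hs h⟩
        · exact Or.inl h
      · rintro (rfl | ⟨hs, hsp⟩)
        · exact ⟨hk, le_rfl⟩
        · exact ⟨hs, hsp.trans hplt.le⟩
    have hnot : k ∉ A.filter (fun s => s ≤ pred k) := by
      simp only [mem_filter, not_and, not_le]; exact fun _ => hplt
    refine ⟨?_, hset1⟩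
    rw [hZ_def]; simp only [hset2, sum_insert hnot]
    rw [div_self hkr.ne', Real.sqrt_one, mul_one, mul_sum]
    congr 1
    refine sum_congr rfl fun s hs => ?_
    have hs0 : (0 : ℝ) ≤ s := Nat.cast_nonneg s
    rw [show (s : ℝ) / k = (pred k : ℝ) / k * ((s : ℝ) / pred k) by field_simp,
      Real.sqrt_mul (by positivity)]
    ring
  -- the per-age analysis at a non-minimal age: the budget bounds the transported pressure, the polynomials close
  have hstep : ∀ k ∈ A, k ≠ m₀ →
      x k * (eb k + 3 / 4) < 1 ∧
      lam (pred k) * ((pred k : ℝ) / k) * (1 + x k / 4) + x k * (1 + eb k) ≤ lam k * (1 - x k * (3 / 4 + eb k)) := by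
    intro k hk hkm
    obtain ⟨hpA, hplt, hpmax⟩ := hpred k hk hkm
    have hkr : (0 : ℝ) < k := by exact_mod_cast hA1 k hk
    have hpr : (0 : ℝ) < pred k := by exact_mod_cast hA1 _ hpA
    have hxk := hx k hk
    obtain ⟨hZk, hset1⟩ := hsplit k hk hkm
    have hb := hbud k hk
    rw [hdiag k (hA1 k hk), hset1] at hb
    -- the budget's young pressure dominates the chain's: √(p/(p+k))·Z_p ≤ Σ_{s≤p} x_s √(s/(s+k))
    have hρ : Real.sqrt ((pred k : ℝ) / ((pred k : ℝ) + k)) * Z (pred k) ≤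
        ∑ s ∈ A.filter (fun s => s ≤ pred k), x s * Real.sqrt ((s : ℝ) / ((s : ℝ) + k)) := by
      rw [hZ_def]; simp only; rw [mul_sum]
      refine sum_le_sum fun s hs => ?_
      have hsA := (mem_filter.mp hs).1; have hsp : s ≤ pred k := (mem_filter.mp hs).2
      have hs1 : (0 : ℝ) < s := by exact_mod_cast hA1 s hsA
      have hsp' : (s : ℝ) ≤ pred k := by exact_mod_cast hsp
      have hle : Real.sqrt ((pred k : ℝ) / ((pred k : ℝ) + k)) * Real.sqrt ((s : ℝ) / pred k) ≤ Real.sqrt ((s : ℝ) / ((s : ℝ) + k)) := by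
        rw [← Real.sqrt_mul (by positivity)]
        apply Real.sqrt_le_sqrt
        rw [show (pred k : ℝ) / ((pred k : ℝ) + k) * ((s : ℝ) / pred k) = (s : ℝ) / ((pred k : ℝ) + k) by field_simp]
        exact div_le_div_of_nonneg_left hs1.le (by positivity) (by linarith)
      calc Real.sqrt ((pred k : ℝ) / ((pred k : ℝ) + k)) * (x s * Real.sqrt ((s : ℝ) / pred k))
          = x s * (Real.sqrt ((pred k : ℝ) / ((pred k : ℝ) + k)) * Real.sqrt ((s : ℝ) / pred k)) := by ring
        _ ≤ x s * Real.sqrt ((s : ℝ) / ((s : ℝ) + k)) := mul_le_mul_of_nonneg_left hle (hx s hsA)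
    have hten' : 10 * (pred k : ℝ) ≤ k := by exact_mod_cast hten k hk hkm
    -- √(p/k) ≤ (21/20)·√(p/(p+k)) (ratio ≥ 10) and √(p/k) ≤ 19/60
    have hsq : Real.sqrt ((pred k : ℝ) / k) ≤ 21 / 20 * Real.sqrt ((pred k : ℝ) / ((pred k : ℝ) + k)) := by
      rw [show (21 : ℝ) / 20 = Real.sqrt ((21 / 20) ^ 2) by rw [Real.sqrt_sq (by norm_num)], ← Real.sqrt_mul (by norm_num)]
      apply Real.sqrt_le_sqrt
      rw [div_le_iff₀ hkr, show (21 / 20 : ℝ) ^ 2 * ((pred k : ℝ) / ((pred k : ℝ) + k)) * k =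
        (21 / 20) ^ 2 * (pred k : ℝ) * k / ((pred k : ℝ) + k) by ring, le_div_iff₀ (by positivity)]
      nlinarith
    have hs19 : Real.sqrt ((pred k : ℝ) / k) ≤ 19 / 60 := by
      rw [show (19 : ℝ) / 60 = Real.sqrt ((19 / 60) ^ 2) by rw [Real.sqrt_sq (by norm_num)]]
      apply Real.sqrt_le_sqrt
      rw [div_le_iff₀ hkr]; nlinarith
    have hs0 : 0 ≤ Real.sqrt ((pred k : ℝ) / k) := Real.sqrt_nonneg _
    have hu0 : 0 ≤ Real.sqrt ((pred k : ℝ) / k) * Z (pred k) := mul_nonneg hs0 (hZ0 _)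
    have hu1 : Real.sqrt ((pred k : ℝ) / k) * Z (pred k) ≤ 21 / 20 * (1 / 2 - 7 / 10 * x k) := by
      have h1 : Real.sqrt ((pred k : ℝ) / k) * Z (pred k) ≤ 21 / 20 * (Real.sqrt ((pred k : ℝ) / ((pred k : ℝ) + k)) * Z (pred k)) := by
        have := mul_le_mul_of_nonneg_right hsq (hZ0 (pred k)); linarith
      have h2 : Real.sqrt ((pred k : ℝ) / ((pred k : ℝ) + k)) * Z (pred k) ≤ 1 / 2 - x k * Real.sqrt (1 / 2) := by linarith
      have h3 : x k * (7 / 10) ≤ x k * Real.sqrt (1 / 2) := mul_le_mul_of_nonneg_left hhalf hxk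
      nlinarith
    -- the chain quantities in the variables s = √(p/k), u = s·Z_p
    have hss : Real.sqrt ((pred k : ℝ) / k) * Real.sqrt ((pred k : ℝ) / k) = (pred k : ℝ) / k := Real.mul_self_sqrt (by positivity)
    have hebk : eb k = 8 * Real.sqrt ((pred k : ℝ) / k) * (Real.sqrt ((pred k : ℝ) / k) * Z (pred k)) := by
      rw [heb_def, hlam_def]; simp only
      linear_combination (-8 * Z (pred k)) * hss
    have hlamp : lam (pred k) * ((pred k : ℝ) / k) = 4 * Real.sqrt ((pred k : ℝ) / k) * (Real.sqrt ((pred k : ℝ) / k) * Z (pred k)) := by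
      rw [hlam_def]; simp only
      linear_combination (-4 * Z (pred k)) * hss
    have hlamk : lam k = 4 * (x k + Real.sqrt ((pred k : ℝ) / k) * Z (pred k)) := by
      rw [hlam_def]; simp only; rw [hZk]
    -- abbreviate
    set sσ : ℝ := Real.sqrt ((pred k : ℝ) / k) with hsσ
    set u : ℝ := sσ * Z (pred k) with hu_def
    have hebu : eb k ≤ 8 * (19 / 60) * u := by rw [hebk]; exact mul_le_mul_of_nonneg_right (by linarith) hu0
    constructor
    · -- the condition
      have hc := cond_poly hxk (hcap k hk) hu0 hu1
      nlinarith [mul_le_mul_of_nonneg_left hebu hxk]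
    · -- the λ-recursion: reduce to step_poly at s = 19/60 by monotonicity in s
      rw [hlamp, hlamk, hebk]
      have hP := step_poly hxk (hcap k hk) hu0 hu1
      -- every s-dependent term enters with a non-positive sign
      have hx4 : 0 ≤ 1 + x k / 4 := by linarith
      have hmono1 : 4 * sσ * u * (1 + x k / 4) ≤ 4 * u * (19 / 60) * (1 + x k / 4) := by
        have := mul_le_mul_of_nonneg_right (mul_le_mul_of_nonneg_right hs19 hu0) hx4; nlinarith
      have hmono2 : x k * (1 + 8 * sσ * u) ≤ x k * (1 + 8 * (19 / 60) * u) := by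
        apply mul_le_mul_of_nonneg_left _ hxk; nlinarith [mul_le_mul_of_nonneg_right hs19 hu0]
      have hmono3 : 4 * (x k + u) * (1 - x k * (3 / 4 + 8 * (19 / 60) * u)) ≤ 4 * (x k + u) * (1 - x k * (3 / 4 + 8 * sσ * u)) := by
        apply mul_le_mul_of_nonneg_left _ (by positivity)
        nlinarith [mul_le_mul_of_nonneg_right hs19 hu0]
      linarith
  -- explicit values of μ
  have hμm : μ m₀ = (3 / 4 * x m₀) / (1 - 3 / 4 * x m₀) := by rw [hμ_def]; exact if_pos rfl
  have hμk : ∀ k, k ≠ m₀ → μ k = (eb k * (1 + x k) + 3 / 4 * x k) / (1 - x k * (3 / 4 + eb k)) := fun k hk => by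
    rw [hμ_def]; exact if_neg hk
  have hμ0 : ∀ k ∈ A, 0 ≤ μ k := by
    intro k hk
    by_cases hkm : k = m₀
    · have h1 := hcap m₀ hm₀
      have h2 := hx m₀ hm₀
      have e : μ k = (3 / 4 * x m₀) / (1 - 3 / 4 * x m₀) := by rw [hkm]; exact hμm
      have hnum : 0 ≤ 3 / 4 * x m₀ := mul_nonneg (by norm_num) h2
      have hden : 0 ≤ 1 - 3 / 4 * x m₀ := by
        have : 3 / 4 * x m₀ ≤ 3 / 4 * (71 / 100) := mul_le_mul_of_nonneg_left h1 (by norm_num)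
        exact sub_nonneg.mpr (this.trans (by norm_num))
      rw [e]; exact div_nonneg hnum hden
    · have h1 := heb0 k
      have h2 := hx k hk
      have h3 := (hstep k hk hkm).1
      have h4 : 0 ≤ eb k * (1 + x k) := mul_nonneg h1 (add_nonneg zero_le_one h2)
      have h5 : 0 ≤ eb k * (1 + x k) + 3 / 4 * x k := add_nonneg h4 (mul_nonneg (by norm_num) h2)
      have h6 : x k * (3 / 4 + eb k) = x k * (eb k + 3 / 4) := by ring
      have h7 : 0 ≤ 1 - x k * (3 / 4 + eb k) := by rw [h6]; exact sub_nonneg.mpr h3.le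
      rw [hμk k hkm]; exact div_nonneg h5 h7
  refine ⟨μ, lam, hμ0, fun k _ => hlam0 k, ?_, ?_, ?_, ?_, ?_⟩
  · -- base μ
    have := hcap m₀ hm₀
    rw [hμm, div_mul_cancel₀ _ (by linarith)]
  · -- base λ
    have hl : lam m₀ = 4 * x m₀ := by rw [hlam_def]; simp only; rw [hZm]
    rw [hl]
    have := hcap m₀ hm₀; have := hx m₀ hm₀
    nlinarith
  · -- condition, with e ≤ eb
    intro k hk hkm
    have h1 := (hstep k hk hkm).1
    have hmin' : min (4 * (pred k : ℝ) * k / ((k : ℝ) + pred k) ^ 2 * μ (pred k)) (2 * lam (pred k) * ((pred k : ℝ) / k)) ≤ eb k := by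
      rw [heb_def]; exact min_le_right _ _
    nlinarith [mul_le_mul_of_nonneg_left hmin' (hx k hk)]
  · -- μ-recursion, by the definition of μ at eb and monotonicity in e
    intro k hk hkm
    have h1 := (hstep k hk hkm).1
    have hxk := hx k hk
    have hmin' : min (4 * (pred k : ℝ) * k / ((k : ℝ) + pred k) ^ 2 * μ (pred k)) (2 * lam (pred k) * ((pred k : ℝ) / k)) ≤ eb k := by
      rw [heb_def]; exact min_le_right _ _
    set e := min (4 * (pred k : ℝ) * k / ((k : ℝ) + pred k) ^ 2 * μ (pred k)) (2 * lam (pred k) * ((pred k : ℝ) / k)) with he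
    have hden : 0 < 1 - x k * (3 / 4 + eb k) := by have := h1; nlinarith [hxk, heb0 k]
    have hμk' : μ k * (1 - x k * (3 / 4 + eb k)) = eb k * (1 + x k) + 3 / 4 * x k := by
      rw [hμk k hkm, div_mul_cancel₀ _ hden.ne']
    have hμ0' : 0 ≤ μ k := hμ0 k hk
    -- e(1+x) + 3x/4 ≤ eb(1+x) + 3x/4 = μ(1 − x(3/4+eb)) ≤ μ(1 − x(3/4+e))
    have h2 : e * (1 + x k) ≤ eb k * (1 + x k) := mul_le_mul_of_nonneg_right hmin' (by linarith)
    have h3 : μ k * (1 - x k * (3 / 4 + eb k)) ≤ μ k * (1 - x k * (3 / 4 + e)) :=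
      mul_le_mul_of_nonneg_left (by nlinarith [mul_le_mul_of_nonneg_left hmin' hxk]) hμ0'
    linarith
  · -- λ-recursion, monotone in e
    intro k hk hkm
    have h2 := (hstep k hk hkm).2
    have hxk := hx k hk
    have hmin' : min (4 * (pred k : ℝ) * k / ((k : ℝ) + pred k) ^ 2 * μ (pred k)) (2 * lam (pred k) * ((pred k : ℝ) / k)) ≤ eb k := by
      rw [heb_def]; exact min_le_right _ _
    set e := min (4 * (pred k : ℝ) * k / ((k : ℝ) + pred k) ^ 2 * μ (pred k)) (2 * lam (pred k) * ((pred k : ℝ) / k)) with he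
    have h3 : x k * (1 + e) ≤ x k * (1 + eb k) := mul_le_mul_of_nonneg_left (by linarith) hxk
    have h4 : lam k * (1 - x k * (3 / 4 + eb k)) ≤ lam k * (1 - x k * (3 / 4 + e)) :=
      mul_le_mul_of_nonneg_left (by nlinarith [mul_le_mul_of_nonneg_left hmin' hxk]) (hlam0 k)
    linarith

end Summit.QuantumFields.BalabanUV.Beta.EriceRemainderEnclosureHistoryAutonomyComparisonTowerChainTen

end
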